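/- Width seat `ym-line-cbag-p1-w3` (prover-ym-line-cbag-p1-w3-g0-0), route `ColdBoxAllGroups`, crux `BoxFloorAllGroups`
(stmt-QuantumFields-22254), line `birth`, lead's PLAN v5: brick B9c «ExponentsG», part 1 (preliminaries: counting, the
link radius, the Gaussian radius, reductions to the target precision, monomial bounds). -/
import Summits.QuantumFields.YangMills.Theorems.ColdBoxAllGroupsBoxFloorAllGroupsChartWindowG
import Mathlib.Analysis.Complex.Exponential

/-!
# Crux `BoxFloorAllGroups`, stub S2, brick B9c «ExponentsG», part 1: preliminaries for the one-scale WINDOW (every error term of the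
# core bound B9a «CoreG» is eventually `≤ β^{−9θ}/5`, for `0 < θ ≤ 1/100`, `ε = 3θ`)

The `G`-generic, CONSTANT-SYMBOLIC replacement of the `SU(2)` numerics `WeakCouplingRatesColdBoxExponents.core_rhs_le_inv_pow` /
`eventually_smallness`.  With `y = β^θ`, `H = ⌈y⌉` (`1 ≤ H ≤ 2y`, `2H+1 ≤ 5y`, `12H²+2H+1 ≤ 53y²`), the LINK RADIUS
`m = 2η_β = 2(12H²+2H+1)·√2·√(β^{6θ−1}) ≤ 106√2·β^{5θ−1/2}`, the Gaussian radius `R = β^{3θ}/(2(√D+1))` (so that the Gaussian chart bound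
`m_E = √D(12H²+2H+1)R/√β ≤ m/5` and `(D/2)R²/β ≤ β^{6θ−1}/8`), the bad mass `p = 240·D·(2H+1)⁴e^{−R²/2}`, `M = β^{6θ}`, `τ = 190βm³`,
`ℓ = 2C₂m²`, `w = 120(2H+1)⁴τ + 4(2H+1)⁴ℓ`:
* this file: `box_counts`, `linkRadius_le` (`m ≤ 106√2·β^{5θ−1/2}`), `eventually_m_le` (`m ≤ κ` eventually), `mE_le_m_div` (`m_E ≤ m/5`),
  `gaussRadius_sq_term_le`, the two reductions `eventually_le_target_of_le_rpow(_mul_exp)` (a term `≤ C·β^s`, `s + 9θ < 0`, resp.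
  `≤ C·β^s·e^{−bβ^a}`, is eventually `≤ β^{−9θ}/5`), and the monomial bounds `linkRadius_pow_le`, `twoH_pow_four_le`, `badMass_le`,
  `sqrt_badMass_le`;
* part 2 (`…ExponentsG`): the window conjuncts and the five error terms, eventually.
Only `θ ≤ 1/100` is used (`40θ < 1/2`).  Tools: `eta_le`, `tendsto_const_mul_rpow_of_neg`, `tendsto_const_mul_rpow_mul_exp_neg`.
No sorry; no definition; standard axioms.  NOT a claim about the mass gap (rung-level support, RECORD label).
-/

set_option autoImplicit false

noncomputable section

open Filter Topology Finset Real

namespace Summit.QuantumFields.YangMills.Theorems.ColdBoxAllGroups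

open Summit.QuantumFields.YangMills.Theorems.WeakCouplingRates

/-! ## Counting in terms of `y = β^θ` -/

/-- `1 ≤ H`, `H ≤ 2y`, `2H+1 ≤ 5y`, `(2H+1)⁴ ≤ 625y⁴`, `12H²+2H+1 ≤ 53y²` for `H = ⌈β^θ⌉`, `y = β^θ ≥ 1` (`β ≥ 1`, `θ ≥ 0`). -/
theorem box_counts {β θ : ℝ} (hβ : 1 ≤ β) (hθ : 0 ≤ θ) :
    1 ≤ ⌈β ^ θ⌉₊ ∧ (⌈β ^ θ⌉₊ : ℝ) ≤ 2 * β ^ θ ∧ (2 * (⌈β ^ θ⌉₊ : ℝ) + 1) ≤ 5 * β ^ θ ∧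
      (2 * (⌈β ^ θ⌉₊ : ℝ) + 1) ^ 4 ≤ 625 * (β ^ θ) ^ 4 ∧
      12 * (⌈β ^ θ⌉₊ : ℝ) ^ 2 + 2 * ⌈β ^ θ⌉₊ + 1 ≤ 53 * (β ^ θ) ^ 2 := by
  obtain ⟨hH1, hH2⟩ := one_le_ceil_rpow_and_le (A := θ) hβ hθ
  have hy : 1 ≤ β ^ θ := Real.one_le_rpow hβ hθ
  have hH1n : 1 ≤ ⌈β ^ θ⌉₊ := by exact_mod_cast hH1
  have h5 : (2 * (⌈β ^ θ⌉₊ : ℝ) + 1) ≤ 5 * β ^ θ := by linarith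
  refine ⟨hH1n, hH2, h5, ?_, by nlinarith⟩
  calc (2 * (⌈β ^ θ⌉₊ : ℝ) + 1) ^ 4 ≤ (5 * β ^ θ) ^ 4 := pow_le_pow_left₀ (by positivity) h5 4
    _ = 625 * (β ^ θ) ^ 4 := by ring

/-- `(β^θ)^n = β^{nθ}` (`β ≥ 0`). -/
theorem rpow_theta_pow {β θ : ℝ} (hβ : 0 ≤ β) (n : ℕ) : (β ^ θ) ^ n = β ^ ((n : ℝ) * θ) := by
  rw [← Real.rpow_natCast, ← Real.rpow_mul hβ, mul_comm]

/-- `√(β^{6θ−1}) = β^{3θ − 1/2}` (`β ≥ 0`). -/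
theorem sqrt_rpow_six {β θ : ℝ} (hβ : 0 ≤ β) : Real.sqrt (β ^ (2 * (3 * θ) - 1)) = β ^ (3 * θ - 1 / 2) := by
  rw [Real.sqrt_eq_rpow, ← Real.rpow_mul hβ]; congr 1; ring

/-! ## The link radius `m = 2η_β` -/

/-- `0 ≤ m`. -/
theorem linkRadius_nonneg (β θ : ℝ) :
    0 ≤ 2 * ((12 * (⌈β ^ θ⌉₊ : ℝ) ^ 2 + 2 * ⌈β ^ θ⌉₊ + 1) * (Real.sqrt 2 * Real.sqrt (β ^ (2 * (3 * θ) - 1)))) := by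
  positivity

/-- `m ≤ 106·√2·β^{5θ − 1/2}` for `β ≥ 1`, `θ ≥ 0` (`eta_le` at `ε = 3θ`). -/
theorem linkRadius_le {β θ : ℝ} (hβ : 1 ≤ β) (hθ : 0 ≤ θ) :
    2 * ((12 * (⌈β ^ θ⌉₊ : ℝ) ^ 2 + 2 * ⌈β ^ θ⌉₊ + 1) * (Real.sqrt 2 * Real.sqrt (β ^ (2 * (3 * θ) - 1)))) ≤
      106 * Real.sqrt 2 * β ^ (5 * θ - 1 / 2) := by
  have h := eta_le (ε := 3 * θ) hβ hθ
  have e : 2 * θ + 3 * θ - 1 / 2 = 5 * θ - 1 / 2 := by ring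
  rw [e] at h
  linarith

/-- **Window: eventually `m ≤ κ`** for any `κ > 0` (`0 ≤ θ`, `θ ≤ 1/100`). -/
theorem eventually_m_le {θ κ : ℝ} (hθ : 0 ≤ θ) (hθ1 : θ ≤ 1 / 100) (hκ : 0 < κ) :
    ∀ᶠ β : ℝ in atTop, 2 * ((12 * (⌈β ^ θ⌉₊ : ℝ) ^ 2 + 2 * ⌈β ^ θ⌉₊ + 1) * (Real.sqrt 2 * Real.sqrt (β ^ (2 * (3 * θ) - 1)))) ≤ κ := by
  have hwin : 2 * θ + 3 * θ < 1 / 2 := by linarith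
  filter_upwards [eventually_eta_le (ε := 3 * θ) hθ hwin (half_pos hκ)] with β hβ
  linarith

/-! ## The Gaussian radius `R = β^{3θ}/(2(√D+1))` and the Gaussian chart bound `m_E` -/

/-- `m_E = √D(12H²+2H+1)R/√β ≤ m/5` for `β ≥ 1` (all `D`): indeed `m_E = (√D/(4√2(√D+1)))·m`. -/
theorem mE_le_m_div (D : ℕ) {β θ : ℝ} (hβ : 1 ≤ β) :
    Real.sqrt D * ((12 * (⌈β ^ θ⌉₊ : ℝ) ^ 2 + 2 * ⌈β ^ θ⌉₊ + 1) * (β ^ (3 * θ) / (2 * (Real.sqrt D + 1)))) / Real.sqrt β ≤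
      2 * ((12 * (⌈β ^ θ⌉₊ : ℝ) ^ 2 + 2 * ⌈β ^ θ⌉₊ + 1) * (Real.sqrt 2 * Real.sqrt (β ^ (2 * (3 * θ) - 1)))) / 5 := by
  have hβ0 : 0 < β := by linarith
  have hsβ : 0 < Real.sqrt β := Real.sqrt_pos.2 hβ0
  have hsq : Real.sqrt (β ^ (2 * (3 * θ) - 1)) = β ^ (3 * θ) / Real.sqrt β := by
    rw [sqrt_rpow_six hβ0.le, Real.sqrt_eq_rpow, Real.rpow_sub hβ0]
  set P : ℝ := 12 * (⌈β ^ θ⌉₊ : ℝ) ^ 2 + 2 * ⌈β ^ θ⌉₊ + 1 with hP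
  have hP0 : 0 ≤ P := by positivity
  have hD0 : 0 ≤ Real.sqrt D := Real.sqrt_nonneg _
  have hs2 : 1 ≤ Real.sqrt 2 := Real.one_le_sqrt.2 (by norm_num)
  rw [hsq]
  -- reduce to `√D/(2(√D+1)) ≤ 2√2/5`
  have hkey : Real.sqrt D / (2 * (Real.sqrt D + 1)) ≤ 2 * Real.sqrt 2 / 5 := by
    rw [div_le_div_iff₀ (by positivity) (by norm_num)]
    have hs14 : (7 : ℝ) / 5 ≤ Real.sqrt 2 := Real.le_sqrt_of_sq_le (by norm_num)
    have h1 : 7 / 5 * Real.sqrt D ≤ Real.sqrt 2 * Real.sqrt D := mul_le_mul_of_nonneg_right hs14 hD0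
    nlinarith
  have hX : 0 ≤ P * β ^ (3 * θ) / Real.sqrt β := by positivity
  calc Real.sqrt D * (P * (β ^ (3 * θ) / (2 * (Real.sqrt D + 1)))) / Real.sqrt β
      = Real.sqrt D / (2 * (Real.sqrt D + 1)) * (P * β ^ (3 * θ) / Real.sqrt β) := by
        field_simp
    _ ≤ 2 * Real.sqrt 2 / 5 * (P * β ^ (3 * θ) / Real.sqrt β) := mul_le_mul_of_nonneg_right hkey hX
    _ = 2 * (P * (Real.sqrt 2 * (β ^ (3 * θ) / Real.sqrt β))) / 5 := by ring

/-- `(D/2)R²/β ≤ β^{6θ−1}/8` (all `D`, `β > 0`). -/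
theorem gaussRadius_sq_term_le (D : ℕ) {β θ : ℝ} (hβ : 0 < β) :
    (D : ℝ) / 2 * (β ^ (3 * θ) / (2 * (Real.sqrt D + 1))) ^ 2 / β ≤ β ^ (2 * (3 * θ) - 1) / 8 := by
  have hD0 : 0 ≤ Real.sqrt D := Real.sqrt_nonneg _
  have hDle : (D : ℝ) ≤ (Real.sqrt D + 1) ^ 2 := by nlinarith [Real.sq_sqrt (Nat.cast_nonneg D)]
  have hy6 : (β ^ (3 * θ)) ^ 2 = β ^ (2 * (3 * θ)) := by rw [← Real.rpow_natCast, ← Real.rpow_mul hβ.le]; congr 1; push_cast; ring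
  have hrhs : β ^ (2 * (3 * θ) - 1) = β ^ (2 * (3 * θ)) / β := by rw [Real.rpow_sub hβ, Real.rpow_one]
  rw [hrhs, div_pow, hy6]
  have hfrac : (D : ℝ) / 2 / (2 * (Real.sqrt D + 1)) ^ 2 ≤ 1 / 8 := by
    rw [div_le_div_iff₀ (by positivity) (by norm_num)]
    nlinarith
  have hpos : 0 ≤ β ^ (2 * (3 * θ)) / β := by positivity
  calc (D : ℝ) / 2 * (β ^ (2 * (3 * θ)) / (2 * (Real.sqrt D + 1)) ^ 2) / β
      = (D : ℝ) / 2 / (2 * (Real.sqrt D + 1)) ^ 2 * (β ^ (2 * (3 * θ)) / β) := by field_simp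
    _ ≤ 1 / 8 * (β ^ (2 * (3 * θ)) / β) := mul_le_mul_of_nonneg_right hfrac hpos
    _ = β ^ (2 * (3 * θ)) / β / 8 := by ring

/-! ## Two `eventually` reductions to the target precision `β^{−9θ}/5` -/

/-- A term bounded by `C·β^s` with `s + 9θ < 0` is eventually `≤ β^{−9θ}/5`. -/
theorem eventually_le_target_of_le_rpow {θ s C : ℝ} {f : ℝ → ℝ} (hs : s + 9 * θ < 0)
    (hf : ∀ β : ℝ, 1 ≤ β → f β ≤ C * β ^ s) : ∀ᶠ β : ℝ in atTop, f β ≤ β ^ (-(9 * θ)) / 5 := by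
  have ht := tendsto_const_mul_rpow_of_neg (5 * C) (s := -(s + 9 * θ)) (by linarith)
  filter_upwards [eventually_le_one_of_tendsto_zero ht, eventually_ge_atTop (1 : ℝ)] with β hg hβ
  have hβ0 : 0 < β := by linarith
  have hX : 0 ≤ β ^ (-(9 * θ)) / 5 := by positivity
  have e : C * β ^ s = (5 * C * β ^ (-(-(s + 9 * θ)))) * (β ^ (-(9 * θ)) / 5) := by
    rw [neg_neg, show 5 * C * β ^ (s + 9 * θ) * (β ^ (-(9 * θ)) / 5) = C * (β ^ (s + 9 * θ) * β ^ (-(9 * θ))) by ring,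
      ← Real.rpow_add hβ0]
    congr 2; ring
  calc f β ≤ C * β ^ s := hf β hβ
    _ = (5 * C * β ^ (-(-(s + 9 * θ)))) * (β ^ (-(9 * θ)) / 5) := e
    _ ≤ 1 * (β ^ (-(9 * θ)) / 5) := mul_le_mul_of_nonneg_right hg hX
    _ = β ^ (-(9 * θ)) / 5 := one_mul _

/-- A term bounded by `C·β^s·e^{−bβ^a}` (`a, b > 0`) is eventually `≤ β^{−9θ}/5`. -/
theorem eventually_le_target_of_le_rpow_mul_exp {θ s a b C : ℝ} {f : ℝ → ℝ} (ha : 0 < a) (hb : 0 < b)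
    (hf : ∀ β : ℝ, 1 ≤ β → f β ≤ C * β ^ s * Real.exp (-(b * β ^ a))) : ∀ᶠ β : ℝ in atTop, f β ≤ β ^ (-(9 * θ)) / 5 := by
  have ht := tendsto_const_mul_rpow_mul_exp_neg (5 * C) (s + 9 * θ) ha hb
  filter_upwards [eventually_le_one_of_tendsto_zero ht, eventually_ge_atTop (1 : ℝ)] with β hg hβ
  have hβ0 : 0 < β := by linarith
  have hX : 0 ≤ β ^ (-(9 * θ)) / 5 := by positivity
  have e : C * β ^ s * Real.exp (-(b * β ^ a)) =
      (5 * C * β ^ (s + 9 * θ) * Real.exp (-(b * β ^ a))) * (β ^ (-(9 * θ)) / 5) := by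
    have : β ^ s = β ^ (s + 9 * θ) * β ^ (-(9 * θ)) := by rw [← Real.rpow_add hβ0]; congr 1; ring
    rw [this]; ring
  calc f β ≤ C * β ^ s * Real.exp (-(b * β ^ a)) := hf β hβ
    _ = (5 * C * β ^ (s + 9 * θ) * Real.exp (-(b * β ^ a))) * (β ^ (-(9 * θ)) / 5) := e
    _ ≤ 1 * (β ^ (-(9 * θ)) / 5) := mul_le_mul_of_nonneg_right hg hX
    _ = β ^ (-(9 * θ)) / 5 := one_mul _

/-! ## Monomial bounds for the ingredients (`β ≥ 1`, `0 ≤ θ`) -/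

/-- `m^k ≤ (106√2)^k · β^{k(5θ−1/2)}`. -/
theorem linkRadius_pow_le {β θ : ℝ} (hβ : 1 ≤ β) (hθ : 0 ≤ θ) (k : ℕ) :
    (2 * ((12 * (⌈β ^ θ⌉₊ : ℝ) ^ 2 + 2 * ⌈β ^ θ⌉₊ + 1) * (Real.sqrt 2 * Real.sqrt (β ^ (2 * (3 * θ) - 1))))) ^ k ≤
      (106 * Real.sqrt 2) ^ k * β ^ ((k : ℝ) * (5 * θ - 1 / 2)) := by
  have hβ0 : 0 < β := by linarith
  have h := pow_le_pow_left₀ (linkRadius_nonneg β θ) (linkRadius_le hβ hθ) k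
  have e : (106 * Real.sqrt 2 * β ^ (5 * θ - 1 / 2)) ^ k = (106 * Real.sqrt 2) ^ k * β ^ ((k : ℝ) * (5 * θ - 1 / 2)) := by
    rw [mul_pow, ← Real.rpow_natCast (β ^ (5 * θ - 1 / 2)) k, ← Real.rpow_mul hβ0.le, mul_comm (5 * θ - 1 / 2)]
  exact h.trans_eq e

/-- `(2H+1)⁴ ≤ 625·β^{4θ}`. -/
theorem twoH_pow_four_le {β θ : ℝ} (hβ : 1 ≤ β) (hθ : 0 ≤ θ) :
    (2 * (⌈β ^ θ⌉₊ : ℝ) + 1) ^ 4 ≤ 625 * β ^ (4 * θ) := by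
  have hβ0 : 0 < β := by linarith
  have h := (box_counts hβ hθ).2.2.2.1
  rwa [rpow_theta_pow hβ0.le 4, show ((4 : ℕ) : ℝ) * θ = 4 * θ by norm_num] at h

/-- `R²/2 = b₀·β^{6θ}` with `b₀ = 1/(8(√D+1)²)`. -/
theorem gaussRadius_sq_div_two (D : ℕ) {β θ : ℝ} (hβ : 0 ≤ β) :
    (β ^ (3 * θ) / (2 * (Real.sqrt D + 1))) ^ 2 / 2 = 1 / (8 * (Real.sqrt D + 1) ^ 2) * β ^ (6 * θ) := by
  have hD : 0 < Real.sqrt D + 1 := by positivity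
  rw [div_pow, ← Real.rpow_natCast (β ^ (3 * θ)) 2, ← Real.rpow_mul hβ]
  have : 3 * θ * ((2 : ℕ) : ℝ) = 6 * θ := by push_cast; ring
  rw [this]
  field_simp
  ring

/-- `p ≤ 150000·D·β^{4θ}·e^{−b₀β^{6θ}}`. -/
theorem badMass_le (D : ℕ) {β θ : ℝ} (hβ : 1 ≤ β) (hθ : 0 ≤ θ) :
    240 * (D : ℝ) * (2 * (⌈β ^ θ⌉₊ : ℝ) + 1) ^ 4 * Real.exp (-((β ^ (3 * θ) / (2 * (Real.sqrt D + 1))) ^ 2 / 2)) ≤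
      150000 * (D : ℝ) * β ^ (4 * θ) * Real.exp (-(1 / (8 * (Real.sqrt D + 1) ^ 2) * β ^ (6 * θ))) := by
  have hβ0 : 0 < β := by linarith
  rw [← gaussRadius_sq_div_two D hβ0.le]
  have h4 := twoH_pow_four_le hβ hθ
  have hD : (0 : ℝ) ≤ D := Nat.cast_nonneg _
  have hexp : 0 ≤ Real.exp (-((β ^ (3 * θ) / (2 * (Real.sqrt D + 1))) ^ 2 / 2)) := (Real.exp_pos _).le
  calc 240 * (D : ℝ) * (2 * (⌈β ^ θ⌉₊ : ℝ) + 1) ^ 4 * Real.exp (-((β ^ (3 * θ) / (2 * (Real.sqrt D + 1))) ^ 2 / 2))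
      ≤ 240 * (D : ℝ) * (625 * β ^ (4 * θ)) * Real.exp (-((β ^ (3 * θ) / (2 * (Real.sqrt D + 1))) ^ 2 / 2)) := by
        gcongr
    _ = _ := by ring

/-- `√p ≤ √(150000·D)·β^{2θ}·e^{−(b₀/2)β^{6θ}}`. -/
theorem sqrt_badMass_le (D : ℕ) {β θ : ℝ} (hβ : 1 ≤ β) (hθ : 0 ≤ θ) :
    Real.sqrt (240 * (D : ℝ) * (2 * (⌈β ^ θ⌉₊ : ℝ) + 1) ^ 4 * Real.exp (-((β ^ (3 * θ) / (2 * (Real.sqrt D + 1))) ^ 2 / 2))) ≤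
      Real.sqrt (150000 * (D : ℝ)) * β ^ (2 * θ) * Real.exp (-(1 / (16 * (Real.sqrt D + 1) ^ 2) * β ^ (6 * θ))) := by
  have hβ0 : 0 < β := by linarith
  refine (Real.sqrt_le_sqrt (badMass_le D hβ hθ)).trans (le_of_eq ?_)
  have h1 : β ^ (4 * θ) = (β ^ (2 * θ)) ^ 2 := by
    rw [← Real.rpow_natCast, ← Real.rpow_mul hβ0.le]; congr 1; push_cast; ring
  have hD1 : (0 : ℝ) < Real.sqrt D + 1 := by positivity
  have h2 : Real.exp (-(1 / (8 * (Real.sqrt D + 1) ^ 2) * β ^ (6 * θ))) =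
      (Real.exp (-(1 / (16 * (Real.sqrt D + 1) ^ 2) * β ^ (6 * θ)))) ^ 2 := by
    rw [← Real.exp_nat_mul]; congr 1; push_cast; field_simp; ring
  rw [h1, h2, show 150000 * (D : ℝ) * (β ^ (2 * θ)) ^ 2 * Real.exp (-(1 / (16 * (Real.sqrt D + 1) ^ 2) * β ^ (6 * θ))) ^ 2 =
      150000 * (D : ℝ) * (β ^ (2 * θ) * Real.exp (-(1 / (16 * (Real.sqrt D + 1) ^ 2) * β ^ (6 * θ)))) ^ 2 by ring,
    Real.sqrt_mul' _ (sq_nonneg _), Real.sqrt_sq (by positivity)]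
  ring

end Summit.QuantumFields.YangMills.Theorems.ColdBoxAllGroups

end
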